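import Mathlib
import HarnessLib
import Literature.MathematicalPhysics.StatisticalMechanics.WeightDominatingParams
import Literature.MathematicalPhysics.StatisticalMechanics.WeightDominatingMultipliers

/-!
# The scalar hypothesis `h73` of the dominated weight tower, for all scales and modes
# (Adams–Buchholz–Kotecký–Müller, Lemma 7.3 with (7.41)–(7.45))

`WeightData.dominated_of_multipliers` (`WeightDominatingMultipliers.lean`) turns the construction of
the dominating sequence of [ABKM19] Lemma 7.5 (v) into the scalar hypothesis

  `h73 : ∀ k κ, κ ≠ 0 → (lam·(m k κ)⁻¹ + (1+θ k)·t (k+1) κ)⁻¹ + δ' (k+1)·m (k+1) κ ≤ domMul lam θ m t (k+1) κ`.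

`WeightDominatingH73.step_of_shellBoundsV` proves it at one mode for `k + 1 ≤ N` and
`WeightDominatingParams.step_of_tail_zero` beyond.  This file packages both into `h73` VERBATIM, for
the multipliers of the line: `m k = derivMul L k s` ((7.32)), `c j κ = cExt N (f κ) j` (real parts of
the Fourier coefficients of the finite-range kernels, zero outside `[1, N+1]`), tails
`t k κ = Σ_{j ∈ [k+1, N+1]} c j κ`, and the parameter recursion `θ (k+1) = θ k − μ·δ' (k+1)` ((7.41)),
`δ' (k+1) = 0` for `k ≥ N`:

* `tailMul`, `tailMul_succ` (`t k = c (k+1) + t (k+1)`), `tailMul_eq_zero_of_le`;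
* **`h73_of_shellBoundsV`**.

Everything is proved; no named fact.

## References
* S. Adams, S. Buchholz, R. Kotecký, S. Müller, arXiv:1910.13564, Lemma 7.3, Lemma 7.5 (v) (7.41)–(7.45)
  [AdamsBuchholzKoteckyMuller2019].
-/

noncomputable section

namespace Literature.MathematicalPhysics.StatisticalMechanics.GradientRG

open Finset Real
open Literature.MathematicalPhysics.StatisticalMechanics.GradientFRD
  (momNorm symbR IsElliptic InShell ShellBoundsV cExt)

variable {d M : ℕ} [NeZero M]

/-- **The tail multipliers** `t k κ = Σ_{j=k+1}^{N+1} c_j(κ)` of the covariances still to be integrated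
after scale `k` ([ABKM19] (7.31): `𝒞_{k+1}^{N+1}`), for the zero-extended coefficients `cExt`.
[cite: AdamsBuchholzKoteckyMuller2019, Lemma 7.3 (7.31)] -/
def tailMul (N : ℕ) (f : (Fin d → ZMod M) → ℕ → ℂ) (k : ℕ) (κ : Fin d → ZMod M) : ℝ :=
  ∑ j ∈ Icc (k + 1) (N + 1), cExt N (f κ) j

omit [NeZero M] in
/-- The tail recursion `t k = c (k+1) + t (k+1)`. [cite: AdamsBuchholzKoteckyMuller2019, Lemma 7.3 (7.31)] -/
theorem tailMul_succ (N : ℕ) (f : (Fin d → ZMod M) → ℕ → ℂ) (k : ℕ) (κ : Fin d → ZMod M) :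
    tailMul N f k κ = cExt N (f κ) (k + 1) + tailMul N f (k + 1) κ := by
  unfold tailMul
  by_cases hk : k + 1 ≤ N + 1
  · have hIoc : Ioc (k + 1) (N + 1) = Icc (k + 1 + 1) (N + 1) := by
      ext j; simp only [mem_Ioc, mem_Icc]; omega
    rw [Finset.Icc_eq_cons_Ioc hk, sum_cons, hIoc]
  · have h1 : Icc (k + 1) (N + 1) = ∅ := Finset.Icc_eq_empty (by omega)
    have h2 : Icc (k + 1 + 1) (N + 1) = ∅ := Finset.Icc_eq_empty (by omega)
    have h3 : cExt N (f κ) (k + 1) = 0 := by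
      unfold cExt; rw [if_neg (by omega)]
    rw [h1, h2, sum_empty, h3, add_zero]

omit [NeZero M] in
/-- The tail vanishes beyond the last scale: `t (k+1) = 0` for `k ≥ N`.
[cite: AdamsBuchholzKoteckyMuller2019, Lemma 7.3 (7.31)] -/
theorem tailMul_eq_zero_of_le (N : ℕ) (f : (Fin d → ZMod M) → ℕ → ℂ) {k : ℕ} (hk : N ≤ k)
    (κ : Fin d → ZMod M) : tailMul N f (k + 1) κ = 0 := by
  unfold tailMul
  rw [Finset.Icc_eq_empty (by omega), sum_empty]

omit [NeZero M] in
/-- The tails are non-negative (for `c, L ≥ 0` in the shell bounds). [cite: AdamsBuchholzKoteckyMuller2019, Thm 6.1 (6.10)] -/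
theorem tailMul_nonneg {N : ℕ} {f : (Fin d → ZMod M) → ℕ → ℂ} (hnn : ∀ κ j, 0 ≤ cExt N (f κ) j)
    (k : ℕ) (κ : Fin d → ZMod M) : 0 ≤ tailMul N f k κ :=
  sum_nonneg fun j _ => hnn κ j

/-- **`h73` for all scales and modes** ([ABKM19] Lemma 7.3 + (7.41)–(7.45)), in the exact shape
consumed by `WeightData.dominated_of_multipliers` with `m k = derivMul L k s`, `t = tailMul N f`,
`θ (k+1) = θ k − μ δ' (k+1)`.  Hypotheses: the geometric/elliptic data of `step_of_shellBoundsV` at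
every mode `κ ≠ 0` (its shell `j' ≤ N` and the (v)-bounds for `f κ`), the symbol inversion, and the
parameter conditions: `θ k ∈ [−1, 1]`, `0 ≤ δ' (k+1) ≤ (4 lam)⁻¹`, `μ δ' (k+1) ≤ 1 + θ k`,
`δ' (k+1) = 0` for `k ≥ N`, `hsmall` (k₀), `hlarge` (μ).
[cite: AdamsBuchholzKoteckyMuller2019, Lemma 7.5 (v)] -/
theorem h73_of_shellBoundsV {L : ℕ} (hL2 : 2 ≤ L) (hd : 1 ≤ d) {n ñ N : ℕ} (hdn : 1 ≤ d - 1 + n)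
    {c C : ℝ} (hc : 0 ≤ c) (hC : 0 ≤ C) {f : (Fin d → ZMod M) → ℕ → ℂ}
    (hshell : ∀ κ : Fin d → ZMod M, κ ≠ 0 → ∃ j', j' ≤ N ∧ InShell L j' κ ∧ ShellBoundsV d n ñ N j' (L : ℝ) c C (f κ))
    {ω₀ Ω₀ : ℝ} {A : Matrix (Fin d) (Fin d) ℝ} (hA : IsElliptic ω₀ Ω₀ A) (hω : 0 < ω₀)
    (hinv : ∀ κ : Fin d → ZMod M, κ ≠ 0 → (∑ j ∈ Icc 1 (N + 1), cExt N (f κ) j) * symbR A κ = 1)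
    {s : Finset (Fin d → ℕ)} (hs : ∀ α ∈ s, 1 ≤ ∑ i, α i)
    (hs1 : ∀ i : Fin d, (Pi.single i 1 : Fin d → ℕ) ∈ s)
    (hs2 : ∀ i : Fin d, (Pi.single i 2 : Fin d → ℕ) ∈ s)
    (hLd : 3 * (d : ℝ) * π ^ 2 ≤ 4 * ((L : ℝ) ^ 2 - 4))
    {lam μ : ℝ} {θ δ' : ℕ → ℝ} (hlam : 0 < lam) (hμ0 : 0 ≤ μ)
    (hθrec : ∀ k, θ (k + 1) = θ k - μ * δ' (k + 1))
    (hθlo : ∀ k, 0 ≤ 1 + θ k) (hθhi : ∀ k, θ k ≤ 1)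
    (hδ0 : ∀ k, 0 ≤ δ' (k + 1)) (hδ : ∀ k, δ' (k + 1) ≤ (4 * lam)⁻¹)
    (hμδ : ∀ k, μ * δ' (k + 1) ≤ 1 + θ k) (hδN : ∀ k, N ≤ k → δ' (k + 1) = 0)
    {k₀ : ℕ}
    (hsmall : ∀ e : ℕ, k₀ + 2 ≤ e →
      4 * (C * (L : ℝ) ^ (2 * (d + ñ) + 1)) * (shellConst s (L : ℝ) e * (d * π ^ 2)) ≤
        lam * ((L : ℝ) ^ (d - 1 + n)) ^ (e + 1))
    (hlarge : ∀ k, shellConst s (L : ℝ) (k₀ + 1) * (d * π ^ 2) *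
        ((1 + θ k) * (ω₀ * (4 / π ^ 2))⁻¹ + lam * (4 / π ^ 2)⁻¹) ^ 2 ≤
      μ * ((c / (L : ℝ) ^ (2 * (d + ñ) + 1)) / ((L : ℝ) ^ 2 * ((L : ℝ) ^ (d - 1 + n)) ^ (k₀ + 2)))) :
    ∀ k (κ : Fin d → ZMod M), κ ≠ 0 →
      (lam * (derivMul (L : ℝ) k s κ)⁻¹ + (1 + θ k) * tailMul N f (k + 1) κ)⁻¹ +
          δ' (k + 1) * derivMul (L : ℝ) (k + 1) s κ ≤
        domMul lam θ (fun k => derivMul (L : ℝ) k s) (tailMul N f) (k + 1) κ := by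
  intro k κ hκ
  -- unfold the target dominator
  show _ ≤ domScalar lam (θ (k + 1)) (derivMul (L : ℝ) (k + 1) s κ) (tailMul N f (k + 1) κ)
  rw [domScalar, hθrec k]
  rcases lt_or_ge k N with hkN | hkN
  · -- scales `k + 1 ≤ N`: Lemma 7.3 at the mode `κ`
    obtain ⟨j', hj'N, hj, hv⟩ := hshell κ hκ
    have h := step_of_shellBoundsV hL2 hd hdn hc hC hκ hj hj'N hv hA hω (hinv κ hκ) hs hs1 hs2 hLd
      hlam (hθlo k) (hθhi k) (hδ0 k) (hδ k) hμ0 (hμδ k) (k := k) (k₀ := k₀) (by omega) hsmall (hlarge k)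
    unfold tailMul
    have hsub : (1 : ℝ) + (θ k - μ * δ' (k + 1)) = 1 + θ k - μ * δ' (k + 1) := by ring
    rw [hsub]
    exact h
  · -- beyond the last scale: `t (k+1) = 0`, `δ' (k+1) = 0`
    rw [tailMul_eq_zero_of_le N f hkN, hδN k hkN]
    have hL1 : (1 : ℝ) ≤ (L : ℝ) := by exact_mod_cast (show 1 ≤ L by omega)
    have h := step_of_tail_zero (θ := θ k) (θ' := θ k - μ * 0) hL1 hs1 hκ hlam k
    simpa using h

end Literature.MathematicalPhysics.StatisticalMechanics.GradientRG

end
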